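import Mathlib.AlgebraicGeometry.Scheme
import HarnessLib

/-!
# `SigmaMaxModificationsCorridor3` (stmt-19249), line `tame_wild` v3: helper **T-shr** —
# separating open neighbourhoods of finitely many closed points

[OURS · L1 W4.2] plan-1's typed row `Helpers.stub_Tshr_separating_opens` (CHAIN v3.0 §5,
`L/w42/helpers-v3.lean`, signature verbatim): the chart-shrinking step of the confined tame transfer
`stub_confinedTameNu3_of_thor4` (lead res-L1-w42-lead-1, tame_wild v3): finitely many closed points
`y i` with open neighbourhoods `V i` admit smaller open neighbourhoods `U i ⊆ V i` with `y j ∉ U i`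
for `j ≠ i` — remove from `V i` the closed finite union of the other points. NOT a statement of any
manuscript under review. [folklore]
-/

set_option linter.dupNamespace false -- mandated namespace of this single-conjunct summit

noncomputable section

open CategoryTheory AlgebraicGeometry TopologicalSpace Topology

namespace Summit.ResolutionOfSingularities.ResolutionOfSingularities.Theorems.SigmaMaxModificationsCorridor3.Helpers

/-- **[OURS · L1 W4.2] T-shr, set level.** In any topological space, finitely many points `y i`
(injectively indexed) with `{y i}` closed and open neighbourhoods `V i ∋ y i` admit open
neighbourhoods `U i ⊆ V i` of `y i` missing all the other `y j`: `U i := V i ∖ ⋃_{j ≠ i} {y j}`.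
[folklore] -/
theorem exists_separating_opens {X : Type*} [TopologicalSpace X] {ι : Type*} [Finite ι]
    (y : ι → X) (hy : Function.Injective y) (hcl : ∀ i, IsClosed ({y i} : Set X))
    (V : ι → Opens X) (hV : ∀ i, y i ∈ V i) :
    ∃ U : ι → Opens X, (∀ i, y i ∈ U i) ∧ (∀ i, U i ≤ V i) ∧ ∀ i j, i ≠ j → y j ∉ U i := by
  classical
  -- the closed finite union of the other points
  have hC : ∀ i, IsClosed (⋃ j : {j : ι // j ≠ i}, ({y j.1} : Set X)) := fun i =>
    isClosed_iUnion_of_finite fun j => hcl j.1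
  refine ⟨fun i => V i ⊓ ⟨(⋃ j : {j : ι // j ≠ i}, ({y j.1} : Set X))ᶜ, (hC i).isOpen_compl⟩,
    fun i => ?_, fun i => inf_le_left, fun i j hij => ?_⟩
  · refine ⟨hV i, ?_⟩
    change y i ∈ (⋃ j : {j : ι // j ≠ i}, ({y j.1} : Set X))ᶜ
    rw [Set.mem_compl_iff, Set.mem_iUnion]
    rintro ⟨⟨j, hj⟩, hij⟩
    exact hj (hy (Set.mem_singleton_iff.mp hij)).symm
  · rintro ⟨-, h⟩
    change y j ∈ (⋃ j' : {j' : ι // j' ≠ i}, ({y j'.1} : Set X))ᶜ at h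
    rw [Set.mem_compl_iff, Set.mem_iUnion] at h
    exact h ⟨⟨j, fun h' => hij h'.symm⟩, Set.mem_singleton _⟩

/-- **[OURS · L1 W4.2] T-shr (plan-1's typed row, CHAIN v3.0 §5 / `L/w42/helpers-v3.lean`, signature
verbatim): chart shrinking at finitely many closed points.** Finitely many closed points `y i` of a
scheme with open neighbourhoods `V i` admit smaller open neighbourhoods `U i ⊆ V i` with `y j ∉ U i`
for `j ≠ i`. With a confining sequence (image of the top stratum = `{y i}`) the traces of the stratum
on the `U i` are then its fibres over the `y i`: clopen, pairwise disjoint, covering — the input of the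
finite disjoint-trace gluing G-fin. [folklore] -/
theorem stub_Tshr_separating_opens
    (Y : Scheme.{0}) {ι : Type} [Finite ι] (y : ι → Y) (hy : Function.Injective y)
    (hcl : ∀ i, IsClosed ({y i} : Set Y)) (V : ι → Y.Opens) (hV : ∀ i, y i ∈ V i) :
    ∃ U : ι → Y.Opens, (∀ i, y i ∈ U i) ∧ (∀ i, U i ≤ V i) ∧ ∀ i j, i ≠ j → y j ∉ U i :=
  exists_separating_opens y hy hcl V hV

end Summit.ResolutionOfSingularities.ResolutionOfSingularities.Theorems.SigmaMaxModificationsCorridor3.Helpers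

end
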